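import Mathlib
import Literature.Analysis.FluidPDE.Tao2016AveragedNS.DSSProfileDictionary
import Summits.NavierStokesRegularity.NavierStokesRegularity.Theorems.WakeRatchetTailRatchet.Negative.TailRatchetFalseOfPersistentDSSWaves
import HarnessLib
import HarnessLib.Audit

/-!
# `WakeRatchet.TailRatchet` (stmt-NavierStokesRegularity-21808) — negative lemma modulo the SCALAR
# dyadic front problem: one real function on `(-∞, 0)` solving a pantograph-type ODE refutes the crux

The companion files `WakeRatchetTailRatchetDSS` / `WakeRatchetTailRatchet/Negative/TailRatchetFalseOfPersistentDSSWaves`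
show that `TailRatchet` forbids EVERY admissible discretely self-similar (DSS) blow-up wave on every
E₂(R) table below a threshold, so that admissible non-trivial DSS waves of the DYADIC member
`dyadicTable ∈ E₂(2)` at arbitrarily small scale ratios refute it (`tailRatchet_false_of_dyadicDSSWaves`).
This file reduces that construction to its barest form.  A DSS blow-up front of the inviscid dyadic
(Katz–Pavlović / Desnyansky–Novikov / Cheskidov) chain `ȧ_n = Λ^{n-1} a_{n-1}² − Λ^n a_n a_{n+1}`,
`Λ = (1+ε₀)^{5/2}`, with blow-up time `0`, time ratio `s > 1` and amplitude ratio `g = s/Λ` per shell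
is `a_n(t) = g^n a(s^n t)` for ONE real function `a` on `t < 0`, and the lattice law is then the single
scalar functional-differential equation
`a'(t) = (Λ/s²) a(t/s)² − (s/Λ) a(t) a(st)`  (`t < 0`)  — `DyadicScalarFronts` asks for such an `a`,
non-trivial, integrable on `(-∞,0)` and bounded near `0⁻`, at arbitrarily small `ε₀`.  THE DICTIONARY
(`isDSSWave_dyadic_of_scalarFront`): `Φ(x) = e^{-x} a(-e^{-x}) e₀` is then an admissible single-profile
DSS wave of `dyadicTable` with delay `T = log s` (per-shell energy ratio `dssMu = s²/Λ²`), via the tree's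
`isSWave_of_dssOrbit`; hence `TailRatchet_false_of_DyadicScalarFronts`.

NUMERICAL STATUS of the hypothesis (evidence on the item, not used here): the one-shell cascade of the
dyadic chain converges to such a front at every tested `Λ ∈ [1.015, 5.66]` (`ε₀ ∈ [0.006, 0.32]`), with
`1 − s²/Λ² ≈ 1.7 ε₀` as `ε₀ → 0`; Kiselev–Zlatoš prove finite-time blow-up of the chain for every `Λ > 1`.
An existence theorem for the front profile is not in print (Dombre–Gilson 1998, Mailybaev 2012/2013:
renormalisation numerics) — it is the construction item this negative lemma is filed modulo.

HONEST FRAMING: statements about a MODEL lattice ODE (Tao 2016 §1.2, §4); nothing here concerns the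
Navier–Stokes equations, and nothing is settled unconditionally.
-/

noncomputable section

set_option linter.dupNamespace false

namespace Summit.NavierStokesRegularity.NavierStokesRegularity.Theorems

namespace WakeRatchetDyadicFront

open MeasureTheory Set
open Literature.Analysis.FluidPDE Literature.Analysis.FluidPDE.TaoCascade
open WakeRatchetTailRatchetNegative

/-! ## The structure maps of the dyadic member -/

/-- The coordinate forms of the dyadic table live on the component triple `(0,0,0)`.
[cite: Tao2016AveragedNS, §1.2 (dyadic model), §4 (4.1); cell vocabulary (`dyadicTable`)] -/
theorem qform_dyadicTable (μ : ℤ × ℤ × ℤ) (y x : Em 4) (i : Fin 4) :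
    qform dyadicTable μ y x i = if i = 0 then dyadicTable 0 0 0 μ * (y 0 * x 0) else 0 := by
  unfold qform
  split_ifs with hi
  · subst hi
    rw [Fintype.sum_eq_single (0 : Fin 4) (fun i₁ hi₁ => Finset.sum_eq_zero fun i₂ _ => by
        have : ¬ (i₁ = 0 ∧ i₂ = 0 ∧ (0 : Fin 4) = 0) := fun h => hi₁ h.1
        simp [dyadicTable_of_not this])]
    rw [Fintype.sum_eq_single (0 : Fin 4) (fun i₂ hi₂ => by
        have : ¬ ((0 : Fin 4) = 0 ∧ i₂ = 0 ∧ (0 : Fin 4) = 0) := fun h => hi₂ h.2.1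
        simp [dyadicTable_of_not this])]
  · refine Finset.sum_eq_zero fun i₁ _ => Finset.sum_eq_zero fun i₂ _ => ?_
    have : ¬ (i₁ = 0 ∧ i₂ = 0 ∧ i = 0) := fun h => hi h.2.2
    simp [dyadicTable_of_not this]

/-- The dyadic table has no intra-shell term: `Q = 0`.
[cite: Tao2016AveragedNS, §1.2, §4 (4.1); cell vocabulary] -/
theorem tableQ_dyadicTable (x : Em 4) : tableQ dyadicTable x = 0 := by
  unfold tableQ
  refine Finset.sum_eq_zero fun i _ => ?_
  rw [qform_dyadicTable]
  split_ifs <;> simp [dyadicTable]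

/-- Outflow of the dyadic table: `A(x) = x₀² e₀`.
[cite: Tao2016AveragedNS, §1.2, §4 (4.1); cell vocabulary] -/
theorem tableA_dyadicTable (x : Em 4) :
    tableA dyadicTable x = (x 0 * x 0) • EuclideanSpace.single 0 (1 : ℝ) := by
  unfold tableA
  rw [Fintype.sum_eq_single (0 : Fin 4) (fun i hi => by rw [qform_dyadicTable, if_neg hi, zero_smul])]
  rw [qform_dyadicTable, if_pos rfl]
  simp [dyadicTable]

/-- Back-reaction of the dyadic table: `B(y, x) = −x₀y₀ e₀`.
[cite: Tao2016AveragedNS, §1.2, §4 (4.1); cell vocabulary] -/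
theorem tableB_dyadicTable (y x : Em 4) :
    tableB dyadicTable y x = (-(x 0 * y 0)) • EuclideanSpace.single 0 (1 : ℝ) := by
  unfold tableB
  rw [Fintype.sum_eq_single (0 : Fin 4) (fun i hi => by
    rw [qform_dyadicTable, qform_dyadicTable, if_neg hi, if_neg hi, add_zero, zero_smul])]
  rw [qform_dyadicTable, qform_dyadicTable, if_pos rfl, if_pos rfl]
  have h1 : dyadicTable 0 0 0 ((1 : ℤ), (0 : ℤ), (0 : ℤ)) = -(1 / 2) := by simp [dyadicTable]
  have h2 : dyadicTable 0 0 0 ((0 : ℤ), (1 : ℤ), (0 : ℤ)) = -(1 / 2) := by simp [dyadicTable]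
  rw [h1, h2]
  congr 1
  ring

/-! ## The dictionary: a scalar front profile is an admissible DSS wave of the dyadic member -/

/-- The image of `x ↦ -e^{-x}` is the negative half-line. [folklore] -/
theorem image_neg_exp_neg : (fun x : ℝ => -Real.exp (-x)) '' univ = Iio 0 := by
  ext t
  constructor
  · rintro ⟨x, -, rfl⟩
    exact neg_neg_iff_pos.2 (Real.exp_pos _)
  · intro ht
    refine ⟨-Real.log (-t), mem_univ _, ?_⟩
    simp only [neg_neg, Real.exp_log (neg_pos.2 ht)]

/-- **The dictionary.**  A solution `a` on `t < 0` of the scalar front equation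
`a'(t) = (Λ/s²) a(t/s)² − (s/Λ) a(t) a(st)` (`Λ = bigLam ε₀`, `s > 1`), integrable on `(-∞,0)` and
bounded near `0⁻`, gives the admissible single-profile DSS wave `Φ(x) = e^{-x} a(-e^{-x}) e₀` of the
dyadic member `dyadicTable` with delay `T = log s` (so `dssMu ε₀ T = s²/Λ²`).
[cite: Tao2016AveragedNS, §1.2 (dyadic model), §4 Lemma 4.1 (4.8) in the self-similar variables of §6.4; cell vocabulary (`IsDSSWave`, `dssEmbed`), tree `isSWave_of_dssOrbit`] -/
theorem isDSSWave_dyadic_of_scalarFront {ε₀ s : ℝ} (hε : 0 < ε₀) (hs : 1 < s) {a : ℝ → ℝ}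
    (hode : ∀ t : ℝ, t < 0 → HasDerivAt a
      (bigLam ε₀ / s ^ 2 * a (t / s) ^ 2 - s / bigLam ε₀ * a t * a (s * t)) t)
    (hint : IntegrableOn a (Iio 0))
    (hbdd : ∃ t₀ : ℝ, t₀ < 0 ∧ ∃ P : ℝ, ∀ t : ℝ, t₀ ≤ t → t < 0 → |a t| ≤ P) :
    IsDSSWave ε₀ dyadicTable (1 : Equiv.Perm (Fin 1)) (Real.log s)
      (fun _ x => (Real.exp (-x) * a (-Real.exp (-x))) • EuclideanSpace.single 0 (1 : ℝ)) := by
  set Λ : ℝ := bigLam ε₀ with hΛ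
  have hΛpos : 0 < Λ := bigLam_pos (by linarith)
  have hΛ0 : Λ ≠ 0 := hΛpos.ne'
  have hs0 : 0 < s := by linarith
  have hsne : s ≠ 0 := hs0.ne'
  set e₀ : Em 4 := EuclideanSpace.single 0 (1 : ℝ) with he₀
  have he₀0 : e₀ 0 = 1 := by simp [he₀]
  -- the three shells `-1, 0, 1` of the DSS orbit in physical time
  set U₀ : ℝ → Em 4 := fun t => a t • e₀ with hU₀
  set Um : ℝ → Em 4 := fun t => (Λ / s * a (t / s)) • e₀ with hUm
  set Up : ℝ → Em 4 := fun t => (s / Λ * a (s * t)) • e₀ with hUp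
  -- homogeneity of the structure maps
  have hQ : ∀ (c : ℝ) (v : Em 4), tableQ dyadicTable (c • v) = c ^ 2 • tableQ dyadicTable v := by
    intro c v; rw [tableQ_dyadicTable, tableQ_dyadicTable, smul_zero]
  have hA : ∀ (c : ℝ) (v : Em 4), Λ⁻¹ • tableA dyadicTable (c • v)
      = c ^ 2 • (Λ⁻¹ • tableA dyadicTable v) := by
    intro c v
    simp only [tableA_dyadicTable, PiLp.smul_apply, smul_eq_mul, smul_smul]
    congr 1; ring
  have hB1 : ∀ (c : ℝ) (v w : Em 4), tableB dyadicTable (c • v) w = c • tableB dyadicTable v w := by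
    intro c v w
    simp only [tableB_dyadicTable, PiLp.smul_apply, smul_eq_mul, smul_smul]
    congr 1; ring
  have hB2 : ∀ (c : ℝ) (v w : Em 4), tableB dyadicTable v (c • w) = c • tableB dyadicTable v w := by
    intro c v w
    simp only [tableB_dyadicTable, PiLp.smul_apply, smul_eq_mul, smul_smul]
    congr 1; ring
  -- the shell-`0` law in physical time
  have hU : ∀ t : ℝ, t < 0 → HasDerivAt U₀ (tableQ dyadicTable (U₀ t)
      + Λ⁻¹ • tableA dyadicTable (Um t) + tableB dyadicTable (Up t) (U₀ t)) t := by
    intro t ht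
    have h := (hode t ht).smul_const e₀
    refine h.congr_deriv ?_
    simp only [hU₀, hUm, hUp, tableQ_dyadicTable, tableA_dyadicTable, tableB_dyadicTable,
      PiLp.smul_apply, he₀0, smul_eq_mul, mul_one, smul_smul, zero_add, ← add_smul]
    congr 1
    field_simp
    ring
  -- the DSS images of shell 0
  have hm : ∀ θ : ℝ, 0 < θ → Um (0 - θ) = (Λ / s) • U₀ (0 - Real.exp (-Real.log s) * θ) := by
    intro θ _
    have harg : (0 - θ) / s = 0 - Real.exp (-Real.log s) * θ := by
      rw [Real.exp_neg, Real.exp_log hs0]; field_simp; ring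
    simp only [hUm, hU₀, smul_smul, harg]
  have hp : ∀ θ : ℝ, 0 < θ → Up (0 - θ) = (Λ / s)⁻¹ • U₀ (0 - Real.exp (Real.log s) * θ) := by
    intro θ _
    have harg : s * (0 - θ) = 0 - Real.exp (Real.log s) * θ := by
      rw [Real.exp_log hs0]; ring
    simp only [hUp, hU₀, smul_smul, harg, inv_div]
  have hlam : Λ = Λ / s * Real.exp (Real.log s) := by
    rw [Real.exp_log hs0]; field_simp
  have hwave := isSWave_of_dssOrbit (V := Em 4) (Q := tableQ dyadicTable)
    (A₀ := fun v => Λ⁻¹ • tableA dyadicTable v) (B₀ := tableB dyadicTable) hQ hA hB1 hB2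
    (div_pos hΛpos hs0) hlam (tstar := 0) hU hm hp
  have hfeed : (fun v : Em 4 => Λ • (Λ⁻¹ • tableA dyadicTable v)) = tableA dyadicTable := by
    funext v
    rw [smul_smul, mul_inv_cancel₀ hΛ0, one_smul]
  rw [hfeed] at hwave
  -- the stated profile family is the dictionary's profile
  have hΦeq : (fun (_ : Fin 1) (x : ℝ) => (Real.exp (-x) * a (-Real.exp (-x))) • e₀)
      = fun _ x => Real.exp (-x) • U₀ (0 - Real.exp (-x)) := by
    funext r x; simp only [hU₀, smul_smul, zero_sub]
  refine ⟨Real.log_pos hs, ?_, ?_, ?_⟩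
  · -- the profile system (single profile, trivial shape permutation)
    rw [hΦeq]
    intro r x
    exact hwave () x
  · -- integrable summed mass: change of variables `t = -e^{-x}`
    have hsm : sMass (fun _ : Fin 1 => fun x : ℝ =>
        (Real.exp (-x) * a (-Real.exp (-x))) • e₀) = fun x => |Real.exp (-x) * a (-Real.exp (-x))| := by
      funext x
      simp [sMass, he₀, norm_smul]
    rw [hsm]
    have hderiv : ∀ x ∈ (univ : Set ℝ), HasDerivWithinAt (fun x : ℝ => -Real.exp (-x))
        (Real.exp (-x)) univ x := by
      intro x _
      have h1 : HasDerivAt (fun y : ℝ => Real.exp (-y)) (Real.exp (-x) * (-1)) x :=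
        (Real.hasDerivAt_exp (-x)).comp x ((hasDerivAt_id x).neg)
      have h2 : HasDerivAt (fun y : ℝ => -Real.exp (-y)) (-(Real.exp (-x) * (-1))) x := h1.neg
      have h3 : HasDerivAt (fun y : ℝ => -Real.exp (-y)) (Real.exp (-x)) x :=
        h2.congr_deriv (by ring)
      exact h3.hasDerivWithinAt
    have hinj : InjOn (fun x : ℝ => -Real.exp (-x)) univ := by
      intro x _ y _ hxy
      have : Real.exp (-x) = Real.exp (-y) := neg_injective hxy
      have := Real.exp_injective this
      linarith
    have key := (integrableOn_image_iff_integrableOn_abs_deriv_smul MeasurableSet.univ hderiv hinj a).1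
      (by rw [image_neg_exp_neg]; exact hint)
    rw [integrableOn_univ] at key
    have key' : Integrable (fun x : ℝ => Real.exp (-x) * a (-Real.exp (-x))) := by
      refine key.congr (Filter.Eventually.of_forall fun x => ?_)
      simp only [smul_eq_mul, abs_of_pos (Real.exp_pos _)]
    exact key'.abs
  · -- weighted energy bounded on a right half-line: `e^{2x} ‖Φ(x)‖² = a(-e^{-x})²`
    obtain ⟨t₀, ht₀, P, hP⟩ := hbdd
    refine ⟨-Real.log (-t₀), P ^ 2, fun x hx => ?_⟩
    have ht : t₀ ≤ -Real.exp (-x) := by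
      have h1 : Real.exp (-x) ≤ Real.exp (Real.log (-t₀)) := Real.exp_le_exp.2 (by linarith)
      rw [Real.exp_log (neg_pos.2 ht₀)] at h1
      linarith
    have hneg : -Real.exp (-x) < 0 := neg_neg_iff_pos.2 (Real.exp_pos _)
    have hPx := hP _ ht hneg
    have hP0 : 0 ≤ P := (abs_nonneg _).trans hPx
    have hw : wEnergy 1 (fun (_ : Fin 1) (x : ℝ) => (Real.exp (-x) * a (-Real.exp (-x))) • e₀) x
        = a (-Real.exp (-x)) ^ 2 := by
      unfold wEnergy sEnergy
      simp only [Finset.univ_unique, Fin.default_eq_zero, Finset.sum_singleton, norm_smul, he₀,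
        PiLp.norm_single, norm_one, mul_one, Real.norm_eq_abs, sq_abs, mul_pow]
      have h0 : (2 : ℝ) * x + ((2 : ℕ) : ℝ) * -x = 0 := by push_cast; ring
      have h1 : Real.exp (2 * x) * Real.exp (-x) ^ 2 = 1 := by
        rw [← Real.exp_nat_mul, ← Real.exp_add, h0, Real.exp_zero]
      calc Real.exp (2 * x) * (Real.exp (-x) ^ 2 * a (-Real.exp (-x)) ^ 2)
          = (Real.exp (2 * x) * Real.exp (-x) ^ 2) * a (-Real.exp (-x)) ^ 2 := by ring
        _ = a (-Real.exp (-x)) ^ 2 := by rw [h1, one_mul]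
    rw [hw, ← sq_abs]
    exact pow_le_pow_left₀ (abs_nonneg _) hPx 2

/-! ## The construction item and the negative lemma -/

/-- **The construction `TailRatchet` is refuted modulo: SCALAR DYADIC FRONTS at arbitrarily small scale
ratios.**  For every `ε > 0` there are `ε₀ ∈ (0, ε]`, a time ratio `s > 1` and a real function `a`,
non-trivial on `t < 0`, integrable on `(-∞, 0)` and bounded near `0⁻`, solving the front equation of
the inviscid dyadic chain at base `Λ = bigLam ε₀ = (1+ε₀)^{5/2}`:
`a'(t) = (Λ/s²) a(t/s)² − (s/Λ) a(t) a(st)` for all `t < 0`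
(then `a_n(t) = (s/Λ)^n a(s^n t)` is an exact DSS blow-up front `ȧ_n = Λ^{n-1}a_{n-1}² − Λ^n a_n a_{n+1}`
with blow-up time `0`, hop-time ratio `1/s`, per-shell energy ratio `s²/Λ²`).  Observed numerically at
every tested `Λ > 1`; no existence theorem is known.
[cite: Tao2016AveragedNS, §1.2 (dyadic model); cell vocabulary (construction item for stmt-21808)] -/
@[conjecture] def DyadicScalarFronts : Prop :=
  ∀ ε : ℝ, 0 < ε → ∃ ε₀ : ℝ, 0 < ε₀ ∧ ε₀ ≤ ε ∧ ∃ s : ℝ, 1 < s ∧ ∃ a : ℝ → ℝ,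
    (∀ t : ℝ, t < 0 → HasDerivAt a
      (bigLam ε₀ / s ^ 2 * a (t / s) ^ 2 - s / bigLam ε₀ * a t * a (s * t)) t) ∧
    IntegrableOn a (Iio 0) ∧
    (∃ t₀ : ℝ, t₀ < 0 ∧ ∃ P : ℝ, ∀ t : ℝ, t₀ ≤ t → t < 0 → |a t| ≤ P) ∧
    ∃ t : ℝ, t < 0 ∧ a t ≠ 0

/-- **Negative lemma: `DyadicScalarFronts → ¬ TailRatchet`.**  Scalar dyadic fronts at arbitrarily
small scale ratios are admissible non-trivial DSS waves of `dyadicTable ∈ E₂(2)`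
(`isDSSWave_dyadic_of_scalarFront`), which `TailRatchet` forbids below its threshold
(`tailRatchet_false_of_dyadicDSSWaves`).
[cite: Tao2016AveragedNS, §1.2, §4; cell vocabulary] -/
theorem TailRatchet_false_of_DyadicScalarFronts :
    DyadicScalarFronts →
      ¬ Summit.NavierStokesRegularity.NavierStokesRegularity.Theses.WakeRatchet.TailRatchet := by
  intro hF
  refine tailRatchet_false_of_dyadicDSSWaves fun ε hε => ?_
  obtain ⟨ε₀, hε₀, hle, s, hs, a, hode, hint, hbdd, t₁, ht₁, hne⟩ := hF ε hε
  refine ⟨ε₀, hε₀, hle, 1, 1, Real.log s, _, isDSSWave_dyadic_of_scalarFront hε₀ hs hode hint hbdd,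
    0, -Real.log (-t₁), ?_⟩
  have ht : -Real.exp (-(-Real.log (-t₁))) = t₁ := by
    rw [neg_neg, Real.exp_log (neg_pos.2 ht₁), neg_neg]
  rw [ht]
  have hpos : Real.exp (-(-Real.log (-t₁))) ≠ 0 := (Real.exp_pos _).ne'
  intro h0
  rw [smul_eq_zero] at h0
  rcases h0 with h0 | h0
  · exact (mul_ne_zero hpos hne) h0
  · exact one_ne_zero ((PiLp.single_eq_zero_iff 2 (0 : Fin 4)).1 h0)

end WakeRatchetDyadicFront

end Summit.NavierStokesRegularity.NavierStokesRegularity.Theorems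

end
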